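import Summits.BirchSwinnertonDyer.BirchSwinnertonDyer.Theorems.ByReductionTypeAtTwoTowerNoFiniteSubmoduleOfCasselsTateAlternating
import Literature.NumberTheory.EllipticCurves.CasselsTateLayerPairing
import HarnessLib

/-!
# Route `ByReductionTypeAtTwo`, TOWER road: the binder `h414` (Greenberg LNM 1716 Prop. 4.14) = PUB(Cassels–Tate layer pairing) ∘ KERNEL

HONEST FRAMING (cell `bsd-2adic`, seat `bsd-2adic-tower-1`; D-0152 kernel hygiene): one theorem, CONDITIONAL on the Literature named fact
`HachimoriMatsuno2000.casselsTate_layerPairing` (the Cassels–Tate pairing on the layers `Sel_{p^∞}(E/K_n)`: alternating, kernel = divisible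
elements, Galois-equivariant, restriction adjoint to corestriction — Cassels 1962 / Silverman X.4.14 + Hachimori–Matsuno 2000 p. 2540 L34–37);
closes no route item; nothing booked; no door re-keyed; BSD is not proved by any of this. It records that the PRINT binder `h414` of the 429 K4
TOWER / λ-rank files (`Greenberg1999.prop414_noFiniteSubmodule_of_not_dvd_torsionOrder`, Greenberg's Prop. 4.14 over `ℚ`) follows from that
ONE generic Cassels–Tate fact by kernel theorems (tower-1 GEN 21/22: `…TowerNoFiniteSubmoduleOf{LayerPackage,CasselsTatePackage,
CasselsTatePairings,CasselsTateAlternating}`, `SubgroupSelmerCorestrictionProofs`; cell `bsd-potss`: `Rank1Residual/Iwasawa/*`).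
-/

set_option autoImplicit false
-- the Theorems namespace of this sub repeats the summit name by design (D-0017 nested layout: Summit.<S>.<Sub>)
set_option linter.dupNamespace false

noncomputable section

namespace Summit.BirchSwinnertonDyer.BirchSwinnertonDyer.Theorems.TowerHaMa

open WeierstrassCurve Literature.NumberTheory.EllipticCurves

/-- **Greenberg's Prop. 4.14 over `ℚ` (the binder `h414`) from the Cassels–Tate layer pairing.** The Literature named fact
`Greenberg1999.prop414_noFiniteSubmodule_of_not_dvd_torsionOrder` HOLDS granted the Literature named fact
`HachimoriMatsuno2000.casselsTate_layerPairing` (at universe `0`), by `prop414_of_casselsTateAlternating` (Galois-equivariance used only at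
the topological generator `γ`). [cite: HachimoriMatsuno2000, Theorem and Corollary (i), proof p. 2540 L28–L45]
[cite: GreenbergLNM1716, §4 Prop. 4.14 (pp. 104–105)] -/
theorem prop414_of_casselsTateLayerPairing (hCT : HachimoriMatsuno2000.casselsTate_layerPairing.{0}) :
    Greenberg1999.prop414_noFiniteSubmodule_of_not_dvd_torsionOrder :=
  prop414_of_casselsTateAlternating fun W _ _ p _ _ κ γ _ _ ↦ by
    obtain ⟨pair, halt, hker, hgal, hadj⟩ := hCT ℚ W p κ
    exact ⟨pair, halt, hker, fun n ↦ hgal n γ, hadj⟩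

end Summit.BirchSwinnertonDyer.BirchSwinnertonDyer.Theorems.TowerHaMa

end
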